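import Literature.MathematicalPhysics.QuantumFieldTheory.Balaban1983to89.B5Display136Torus
import Literature.MathematicalPhysics.QuantumFieldTheory.Balaban1983to89.B4Sect5Torus

/-!
# (1.137) of Bałaban [5] for the concrete scalar torus tower: the model-evident hypotheses DISCHARGED

B5 = T. Bałaban, *Propagators and renormalization transformations for lattice gauge theories. I*,
Commun. Math. Phys. **95** (1984) 17–40 [cite: Balaban1984PropagatorsI]; [4] = CMP **89** (1983) 571–597
[cite: Balaban1983RegularityDecay].
Cell records: GAPS G-pv07-5 (residues R1–R4), C-pv07-19/20 (`B5Display136Torus`), this module = node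
G-pv07-5c (b2b-balaban-pv07-g6); v1.1 = DOCFIX only (XREAD C-pv15g5-3 D1/D2: title line, p. 39 locator; GAPS
C-pv07-30).  value = kernel certificate for a by-reference step, NOT summit progress.

## What this module does

`B5Ineq137.ineq137_of_display136` (b05 lineage) derives the pointwise estimate (1.137) of B5 p. 40 from the
operator identity (1.136), the located leaf `Leaf235to237` (the decay estimates of [4] Lemma 2.4 /
(2.35)–(2.37) read on the whole torus — B5 p. 39: *"We use Lemma 2.4 of that paper and the equality (2.34) with □
replaced by the whole torus"*) and three packages of MODEL-EVIDENT HYPOTHESES invisible to the abstract carrier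
`B5Ineq137.ScaleData`: `Geometry` (non-negativity and the triangle inequality of the three distances, two cube
facts), `RowSums` (unit-lattice row sums and the Riemann sum of the display, uniformly in the scale) and `NormFacts`
(the sup and Hölder norms (1.108)–(1.109)).  `B5Display136Torus` (pv07-g6) proved (1.136) for the CONCRETE scalar
torus tower of `B1RG242Torus` (`display136_of_tower`) but still took `Geometry`, `RowSums`, `NormFacts` as
hypotheses (`ineq137_of_tower`), its auxiliary data `Aux` (norms, distances, cubes) being free parameters.

Here the auxiliary data are made CONCRETE and the three packages become KERNEL THEOREMS:
* §1–§2: the tori `T^{(j)} = Site P j` are read as `B4Sect5Torus.TSite`s (`siteEquiv`), with the sup torus distance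
  `T P j` in lattice units (a genuine metric: `T_triangle`, `eq_of_T_eq_zero`; row sums `rowSum_T_le` from
  `B4Sect5Torus.torusSum_le`, uniformly in the torus); the CORNER REPRESENTATIVE `fine P i y ∈ T^{(0)}` of a coarse
  site (coordinates `L^i y_μ`; `T_fine_fine`: distances scale exactly by `L^i`) and the BLOCK MAP `blk`
  (`T_blk_le`: a fine point is within `L^j − 1` of the corner of its block);
* §3: the distances of (1.136)–(1.137) in η-units, η = L^{−k} (k = `S.k`): `distX x x′ = L^{−k}T(x,x′)` on T_η,
  `dXU j x y = L^{−j}T(x, fine y)` (= |(L^jη)^{−1}x − y|) and `dUU j y y′ = L^{−j}T(fine y, fine y′)` (= |y − y′| of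
  `T₁^{(j)}`, `dUU_level`), for points `y` of the disjoint union of all unit lattices; THEOREMS: `tri` (the triangle
  inequality of `Geometry`), `rowXU_le` / `rowUU_le` (≤ `e^{κ}K_d(κ)`, via the key lemma `rowFine_le`:
  |L^{−j}p − y| ≥ |blk p − y|_{T^{(j)}} − 1), `lat_le` (the Riemann sum ≤ `Λ = (1 + 2/κ)(4d/κ + 2)^d`, from
  `(1 + u)e^{−κu} ≤ (1 + 2/κ)e^{−κu/2}` and `L^{−jd}K_d(κ/(2L^j)) ≤ (4d/κ + 2)^d`);
* §4: the norms on scalar functions of T_η — B5 p. 35 [PDF 19] (1.108) *"|A| = max_μ sup_x |A_μ(x)|"* and (1.109)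
  *"‖A‖_α = max_μ sup_{x,x′:|x−x′|≤1} |x − x′|^{−α}|A_μ(x) − A_μ(x′)|"* read for one component: `supN`, `holN`
  (finite sups); THEOREMS `le_supN`, `holder_le` (`NormFacts`);
* §5: `aux` = these data + the two remaining free inputs (the cube relation `x ∈ Δ̃(y)` towards the ABSTRACT sites
  `S.Site` of `B5.Setting`, and the component map `J ↦ J_ν`); `geometry` (cube facts = hypothesis `CubeFacts`),
  `rowSums`, `normFacts`; **`ineq137_torus`**: (1.137) for the concrete tower from `Leaf235to237` + `CubeFacts` only,
  with explicit constants (`R = e^{δ′₀/4}K_d(δ′₀/4)`, `Λ = Lam d (δ′₀/4)`, `δ = ½δ′₀`);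
* §6: the MODEL cube relation — B5 p. 35 [PDF 19]: *"To describe decay properties we use two families of cubes, both
  parametrized by points of the unit lattice T₁^{(k)}. Cubes Δ(y) are simply unit cubes of T_η, or Δ(y) = B^k(y),
  y ∈ T₁^{(k)}. Cubes Δ̃(y) are sums of 2^d unit cubes having the point y as a corner, thus they are cubes of size 2
  and with a center at y."* — `modelCube σ x y :⇔ T(x, fine (σ y)) ≤ L^k` (the closed sup-ball of radius 1 in
  η-units about the corner representative of `σ y`) for a map `σ : S.Site → T^{(k)}`; if `σ` is ISOMETRIC for
  `S.dist` the two cube facts hold with `c = 2` (`cubeFacts_model`, triangle inequality), whence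
  **`ineq137_torus_model`**: (1.137) from the located leaf ALONE, given the identification `σ`.

## What is NOT proved here (located, unchanged)

(i) `Leaf235to237` — the decay estimates of [4] Lemma 2.4 on the torus for the kernels K0–K3 of the concrete tower
(residue (R3) of G-pv07-5: printed for parallelepipeds with Neumann conditions; torus engine `B4Sect5Torus`); it is a
HYPOTHESIS of both final theorems, exactly as in `B5Ineq137`.  (ii) The identification of `B5.Setting`'s abstract
unit-lattice sites and distance with `T^{(k)}` and its sup torus distance (`σ`, `hσ`), resp. the cube facts for an
arbitrary cube relation (`CubeFacts`): `B5.Setting` is an abstract 22-field record, so this link cannot be a theorem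
about the torus alone.  (iii) Nothing about U ≠ 1 (residue (R2)).  No cited fact is added by this module; every
`[cite:]` tag below documents provenance of a DEFINITION's reading, all theorems are kernel-proved.

## Conventions (DIVERGENCE D-pv07.17)

(a) Distances are the SUP (ℓ^∞) torus distances of `B4Sect5Torus` (F2: the papers do not fix ℓ¹/ℓ^∞; the sup metric
makes "cubes of size 2" closed balls of radius 1 and carries the uniform row-sum engine `torusSum_le`); `Setup`'s ℓ¹
`Site.tdist` is not used.  (b) A unit-lattice point `y ∈ T₁^{(j)}` is placed in the fine torus at the CORNER of its
block (F3, `fine`), so |(L^jη)^{−1}x − y| is the distance to the block corner; B5's "center at y" for Δ̃(y) is then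
literal (Δ̃(y) = the 2^d blocks around the corner point).  (c) `modelCube` is the CLOSED ball (it contains the upper
faces that the half-open blocks exclude): as Δ̃ enters (1.137) only through the hypotheses x ∈ Δ̃(y), supp f ⊂ Δ̃(y′),
the closed-ball statement implies the printed one.  (d) η = L^{−S.k} is declared by `distX` (only relative scales
enter (1.137)); the levels used are `j < S.k ≤ m + K + 1` (`ineq137_torus`; `≤ m + K` in §6, where `T^{(S.k)}` itself
is needed), all genuine tori of `Params`; `d ≥ 1` (`Params.hd`) is used in `lat_le`.  (e) Constants are explicit but
not optimised.
-/

namespace Literature.MathematicalPhysics.QuantumFieldTheory.Balaban1983to89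

namespace B5Ineq137Torus

open B4TorusKernel.MultiPeriod (circAbs circAbs_nonneg circAbs_le_abs)

noncomputable section

variable (P : Params)

/-! ## §1 The tori T^{(j)} as `TSite`s and their sup torus distance -/

/-- The period vector of `T^{(j)}`: `sitesPerDir j` in every direction. [folklore] -/
def Nv (j : ℕ) : Fin P.d → ℕ := fun _ => P.sitesPerDir j

/-- Every period is `≥ 1`. [folklore] -/
theorem Nv_pos (j : ℕ) : ∀ i, 1 ≤ Nv P j i := fun _ => (P.one_lt_sitesPerDir j).le

variable {P} in
/-- A site of `T^{(j)}` read as a point of the `TSite` torus with the same periods (coordinates `val`). [folklore] -/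
def toT {j : ℕ} (x : Site P j) : B4Sect5Torus.TSite P.d (Nv P j) := fun μ => ⟨(x μ).val, ZMod.val_lt (x μ)⟩

/-- `toT` is injective. [folklore] -/
theorem toT_injective (j : ℕ) : Function.Injective (toT (P := P) (j := j)) := by
  intro x y h
  funext μ
  have hμ := congrArg (fun t : B4Sect5Torus.TSite P.d (Nv P j) => (t μ).val) h
  exact ZMod.val_injective _ hμ

/-- `toT` is a bijection `Site P j ≃ TSite`. [folklore] -/
def siteEquiv (j : ℕ) : Site P j ≃ B4Sect5Torus.TSite P.d (Nv P j) where
  toFun := toT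
  invFun t := fun μ => ((t μ).val : ZMod (P.sitesPerDir j))
  left_inv x := by
    funext μ
    exact ZMod.natCast_zmod_val (x μ)
  right_inv t := by
    funext μ
    apply Fin.ext
    show (((t μ).val : ZMod (P.sitesPerDir j))).val = (t μ).val
    rw [ZMod.val_natCast]
    exact Nat.mod_eq_of_lt (t μ).isLt

/-- **The sup torus distance of `T^{(j)}` in lattice units** (`max_μ dist(x_μ − y_μ, N_jℤ)`, real-valued). [folklore] -/
def T (j : ℕ) (x y : Site P j) : ℝ := B4Sect5Torus.tdist (Nv P j) (toT x) (toT y)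

/-- `T ≥ 0`. [folklore] -/
theorem T_nonneg (j : ℕ) (x y : Site P j) : 0 ≤ T P j x y := B4Sect5Torus.tdist_nonneg _ _ _

/-- `T` is symmetric. [folklore] -/
theorem T_symm (j : ℕ) (x y : Site P j) : T P j x y = T P j y x := B4Sect5Torus.tdist_symm (Nv_pos P j) _ _

/-- `T x x = 0`. [folklore] -/
theorem T_self (j : ℕ) (x : Site P j) : T P j x x = 0 := B4Sect5Torus.tdist_self _ _

/-- The triangle inequality for `T`. [folklore] -/
theorem T_triangle (j : ℕ) (x y z : Site P j) : T P j x z ≤ T P j x y + T P j y z :=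
  B4Sect5Torus.tdist_triangle (Nv_pos P j) _ _ _

/-- `T` is a genuine metric: distance `0` forces equality (pattern of `B6BondEliminationTorus.eq_of_tdist_eq_zero`).
[folklore] -/
theorem eq_of_T_eq_zero {j : ℕ} {x y : Site P j} (h : T P j x y = 0) : x = y := by
  apply toT_injective P j
  funext i
  have hP := Nv_pos P j
  have h1 := B4Sect5Torus.circAbs_le_tdist hP (toT x) (toT y) i
  unfold T at h
  rw [h] at h1
  have h2 := circAbs_nonneg (hP i) ((((toT x) i).val : ℤ) - (((toT y) i).val : ℤ))
  have h3 : circAbs (Nv P j i) ((((toT x) i).val : ℤ) - (((toT y) i).val : ℤ)) = 0 :=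
    le_antisymm (by exact_mod_cast h1) h2
  unfold B4TorusKernel.MultiPeriod.circAbs at h3
  have hPi : (0 : ℤ) < (Nv P j i : ℤ) := by exact_mod_cast hP i
  have hlt : ((((toT x) i).val : ℤ) - (((toT y) i).val : ℤ)) % (Nv P j i : ℤ) < (Nv P j i : ℤ) :=
    Int.emod_lt_of_pos _ hPi
  have hnn : 0 ≤ ((((toT x) i).val : ℤ) - (((toT y) i).val : ℤ)) % (Nv P j i : ℤ) := Int.emod_nonneg _ hPi.ne'
  have hmod : ((((toT x) i).val : ℤ) - (((toT y) i).val : ℤ)) % (Nv P j i : ℤ) = 0 := by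
    rcases min_choice (((((toT x) i).val : ℤ) - (((toT y) i).val : ℤ)) % (Nv P j i : ℤ))
      ((Nv P j i : ℤ) - ((((toT x) i).val : ℤ) - (((toT y) i).val : ℤ)) % (Nv P j i : ℤ)) with hm | hm <;>
      rw [hm] at h3 <;> omega
  have hx : (((toT x) i).val : ℤ) < (Nv P j i : ℤ) := by exact_mod_cast ((toT x) i).isLt
  have hy : (((toT y) i).val : ℤ) < (Nv P j i : ℤ) := by exact_mod_cast ((toT y) i).isLt
  have hdvd : (Nv P j i : ℤ) ∣ ((((toT x) i).val : ℤ) - (((toT y) i).val : ℤ)) := Int.dvd_of_emod_eq_zero hmod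
  have heq : (((toT x) i).val : ℤ) = (((toT y) i).val : ℤ) := by
    rcases hdvd with ⟨k, hk⟩
    have hk0 : k = 0 := by
      by_contra hne
      rcases lt_or_gt_of_ne hne with hlt' | hgt'
      · nlinarith
      · nlinarith
    rw [hk0, mul_zero, sub_eq_zero] at hk
    exact hk
  exact Fin.ext (by exact_mod_cast heq)

/-- Row sums over `T^{(j)}` at any rate `a > 0` are bounded by `K_d(a)`, uniformly in the torus
(`B4Sect5Torus.torusSum_le` through `siteEquiv`). [folklore] -/
theorem rowSum_T_le (j : ℕ) {a : ℝ} (ha : 0 < a) (x : Site P j) :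
    ∑ y : Site P j, Real.exp (-(a * T P j x y)) ≤ B4Sect5Proof.latticeConst P.d a := by
  have h := B4Sect5Torus.torusSum_le P.d (Nv_pos P j) ha (toT x)
  calc ∑ y : Site P j, Real.exp (-(a * T P j x y))
      = ∑ t : B4Sect5Torus.TSite P.d (Nv P j), Real.exp (-(a * B4Sect5Torus.tdist (Nv P j) (toT x) t)) :=
        Fintype.sum_equiv (siteEquiv P j) _ _ (fun y => rfl)
    _ ≤ B4Sect5Proof.latticeConst P.d a := h

/-! ## §2 Fine-lattice representatives of the coarse sites and the block map -/

/-- `L^i · N_i = N_0` for `i ≤ m + K`. [folklore] -/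
theorem pow_mul_sitesPerDir {i : ℕ} (hi : i ≤ P.m + P.K) : P.L ^ i * P.sitesPerDir i = P.sitesPerDir 0 := by
  unfold Params.sitesPerDir
  rw [Nat.sub_zero, mul_left_comm, ← pow_add, Nat.add_sub_cancel' hi]

/-- The CORNER REPRESENTATIVE of a site `y ∈ T^{(i)}` in the finest torus `T^{(0)}`: coordinates `L^i · y_μ`
(the corner-anchored blocks of `TorusGeometry`, DIVERGENCE F3, iterated `i` times). [folklore] -/
def fine (i : ℕ) (y : Site P i) : Site P 0 := fun μ => ((P.L ^ i * (y μ).val : ℕ) : ZMod (P.sitesPerDir 0))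

/-- Coordinates of the corner representative: `L^i · y_μ` (no wrap-around for `i ≤ m + K`). [folklore] -/
theorem fine_val {i : ℕ} (hi : i ≤ P.m + P.K) (y : Site P i) (μ : Fin P.d) :
    (fine P i y μ).val = P.L ^ i * (y μ).val := by
  unfold fine
  rw [ZMod.val_natCast]
  apply Nat.mod_eq_of_lt
  calc P.L ^ i * (y μ).val < P.L ^ i * P.sitesPerDir i :=
        Nat.mul_lt_mul_of_pos_left (ZMod.val_lt (y μ)) (pow_pos P.L_pos i)
    _ = P.sitesPerDir 0 := pow_mul_sitesPerDir P hi

/-- The BLOCK MAP `T^{(0)} → T^{(j)}`: integer division of the coordinates by `L^j`. [folklore] -/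
def blk (j : ℕ) (p : Site P 0) : Site P j := fun μ => (((p μ).val / P.L ^ j : ℕ) : ZMod (P.sitesPerDir j))

/-- Coordinates of the block: `⌊p_μ / L^j⌋`. [folklore] -/
theorem blk_val {j : ℕ} (hj : j ≤ P.m + P.K) (p : Site P 0) (μ : Fin P.d) :
    (blk P j p μ).val = (p μ).val / P.L ^ j := by
  unfold blk
  rw [ZMod.val_natCast]
  apply Nat.mod_eq_of_lt
  apply Nat.div_lt_of_lt_mul
  rw [pow_mul_sitesPerDir P hj]
  exact ZMod.val_lt (p μ)

/-- `circAbs` scales: `dist(c z, c N ℤ) = c · dist(z, N ℤ)`. [folklore] -/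
theorem circAbs_mul_mul {c : ℕ} (hc : 0 < c) (N : ℕ) (z : ℤ) :
    circAbs (c * N) ((c : ℤ) * z) = (c : ℤ) * circAbs N z := by
  unfold B4TorusKernel.MultiPeriod.circAbs
  have hc' : (0 : ℤ) < (c : ℤ) := by exact_mod_cast hc
  rw [Nat.cast_mul, Int.mul_emod_mul_of_pos _ _ hc', ← mul_sub]
  rcases le_total (z % (N : ℤ)) ((N : ℤ) - z % (N : ℤ)) with h | h
  · rw [min_eq_left h, min_eq_left (mul_le_mul_of_nonneg_left h hc'.le)]
  · rw [min_eq_right h, min_eq_right (mul_le_mul_of_nonneg_left h hc'.le)]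

/-- Coordinate distances of corner representatives are `L^j` times the coordinate distances in `T^{(j)}`. [folklore] -/
theorem ccoord_fine {j : ℕ} (hj : j ≤ P.m + P.K) (a b : Site P j) (μ : Fin P.d) :
    B4Sect5Torus.ccoord (Nv P 0) (toT (fine P j a)) (toT (fine P j b)) μ =
      P.L ^ j * B4Sect5Torus.ccoord (Nv P j) (toT a) (toT b) μ := by
  have e1 : ((toT (fine P j a)) μ).val = P.L ^ j * (a μ).val := fine_val P hj a μ
  have e2 : ((toT (fine P j b)) μ).val = P.L ^ j * (b μ).val := fine_val P hj b μ
  have ea : ((toT a) μ).val = (a μ).val := rfl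
  have eb : ((toT b) μ).val = (b μ).val := rfl
  apply Int.ofNat.inj
  simp only [Int.ofNat_eq_natCast]
  rw [B4Sect5Torus.ccoord_cast (Nv_pos P 0), Nat.cast_mul, B4Sect5Torus.ccoord_cast (Nv_pos P j), e1, e2, ea, eb]
  show circAbs (P.sitesPerDir 0) _ = _
  rw [← pow_mul_sitesPerDir P hj, Nat.cast_mul, Nat.cast_mul, ← mul_sub]
  exact circAbs_mul_mul (pow_pos P.L_pos j) (P.sitesPerDir j) _


/-- Distances of corner representatives in `T^{(0)}` are exactly `L^j` times the distances in `T^{(j)}`. [folklore] -/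
theorem T_fine_fine {j : ℕ} (hj : j ≤ P.m + P.K) (a b : Site P j) :
    T P 0 (fine P j a) (fine P j b) = (P.L : ℝ) ^ j * T P j a b := by
  unfold T B4Sect5Torus.tdist
  have hfun : B4Sect5Torus.ccoord (Nv P 0) (toT (fine P j a)) (toT (fine P j b)) =
      (fun n => P.L ^ j * n) ∘ B4Sect5Torus.ccoord (Nv P j) (toT a) (toT b) := by
    funext μ; exact ccoord_fine P hj a b μ
  have h : Finset.univ.sup (B4Sect5Torus.ccoord (Nv P 0) (toT (fine P j a)) (toT (fine P j b))) =
      P.L ^ j * Finset.univ.sup (B4Sect5Torus.ccoord (Nv P j) (toT a) (toT b)) := by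
    rw [hfun, ← Finset.apply_sup_eq_sup_comp (fun n => P.L ^ j * n)]
    · intro x y
      exact Monotone.map_max fun u v huv => Nat.mul_le_mul_left (P.L ^ j) huv
    · show P.L ^ j * (0 : ℕ) = 0
      exact Nat.mul_zero _
  rw [h]
  push_cast
  ring

/-- A fine site is within `L^j − 1` of the corner of its `L^j`-block (coordinatewise remainders). [folklore] -/
theorem T_blk_le {j : ℕ} (hj : j ≤ P.m + P.K) (p : Site P 0) :
    T P 0 p (fine P j (blk P j p)) ≤ (P.L : ℝ) ^ j - 1 := by
  unfold T B4Sect5Torus.tdist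
  have hL1 : 1 ≤ P.L ^ j := Nat.one_le_pow _ _ P.L_pos
  have h : Finset.univ.sup (B4Sect5Torus.ccoord (Nv P 0) (toT p) (toT (fine P j (blk P j p)))) ≤ P.L ^ j - 1 := by
    apply Finset.sup_le
    intro μ _
    have ev : ((toT (fine P j (blk P j p))) μ).val = P.L ^ j * ((p μ).val / P.L ^ j) := by
      show (fine P j (blk P j p) μ).val = _
      rw [fine_val P hj, blk_val P hj]
    have ep : ((toT p) μ).val = (p μ).val := rfl
    unfold B4Sect5Torus.ccoord
    rw [ev, ep]
    have hdm := Nat.div_add_mod (p μ).val (P.L ^ j)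
    have hr : ((p μ).val : ℤ) - ((P.L ^ j * ((p μ).val / P.L ^ j) : ℕ) : ℤ) = (((p μ).val % P.L ^ j : ℕ) : ℤ) := by
      omega
    rw [hr]
    have hle : circAbs (Nv P 0 μ) (((p μ).val % P.L ^ j : ℕ) : ℤ) ≤ (((p μ).val % P.L ^ j : ℕ) : ℤ) := by
      have := circAbs_le_abs (Nv_pos P 0 μ) (((p μ).val % P.L ^ j : ℕ) : ℤ)
      rwa [abs_of_nonneg (by positivity)] at this
    have hlt : (p μ).val % P.L ^ j < P.L ^ j := Nat.mod_lt _ (pow_pos P.L_pos j)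
    apply Int.toNat_le.mpr
    have : (((p μ).val % P.L ^ j : ℕ) : ℤ) ≤ ((P.L ^ j - 1 : ℕ) : ℤ) := by omega
    exact le_trans hle this
  calc ((Finset.univ.sup (B4Sect5Torus.ccoord (Nv P 0) (toT p) (toT (fine P j (blk P j p)))) : ℕ) : ℝ)
      ≤ ((P.L ^ j - 1 : ℕ) : ℝ) := by exact_mod_cast h
    _ = (P.L : ℝ) ^ j - 1 := by rw [Nat.cast_sub hL1]; push_cast; ring

/-- KEY ROW-SUM LEMMA: for ANY fine point `p` and any level `j ≤ m + K`, the unit-lattice row sum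
`Σ_{y ∈ T₁^{(j)}} e^{−κ |L^{−j}p − y|}` (distance through corner representatives) is `≤ e^{κ} K_d(κ)`, uniformly in
the torus: `|L^{−j}p − y| ≥ |B(p) − y|_{T^{(j)}} − 1` with `B` the block map, then `rowSum_T_le`. [folklore] -/
theorem rowFine_le {j : ℕ} (hj : j ≤ P.m + P.K) {κ : ℝ} (hκ : 0 < κ) (p : Site P 0) :
    ∑ y : Site P j, Real.exp (-(κ * ((((P.L : ℝ) ^ j)⁻¹) * T P 0 p (fine P j y)))) ≤
      Real.exp κ * B4Sect5Proof.latticeConst P.d κ := by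
  have hLj : (0 : ℝ) < (P.L : ℝ) ^ j := pow_pos P.cast_L_pos j
  have hterm : ∀ y : Site P j, Real.exp (-(κ * ((((P.L : ℝ) ^ j)⁻¹) * T P 0 p (fine P j y)))) ≤
      Real.exp κ * Real.exp (-(κ * T P j (blk P j p) y)) := by
    intro y
    rw [← Real.exp_add]
    apply Real.exp_le_exp.mpr
    -- T(fine (blk p), fine y) ≤ T(fine (blk p), p) + T(p, fine y)
    have h1 := T_triangle P 0 (fine P j (blk P j p)) p (fine P j y)
    rw [T_fine_fine P hj, T_symm P 0 (fine P j (blk P j p)) p] at h1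
    have h2 := T_blk_le P hj p
    -- so L^j T_j(blk p, y) - (L^j - 1) ≤ T(p, fine y)
    have h3' : (P.L : ℝ) ^ j * (T P j (blk P j p) y - 1) ≤ T P 0 p (fine P j y) := by nlinarith
    have h3 : T P j (blk P j p) y - 1 ≤ (((P.L : ℝ) ^ j)⁻¹) * T P 0 p (fine P j y) := by
      have := mul_le_mul_of_nonneg_left h3' (inv_nonneg.mpr hLj.le)
      rwa [← mul_assoc, inv_mul_cancel₀ hLj.ne', one_mul] at this
    nlinarith
  calc ∑ y : Site P j, Real.exp (-(κ * ((((P.L : ℝ) ^ j)⁻¹) * T P 0 p (fine P j y))))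
      ≤ ∑ y : Site P j, Real.exp κ * Real.exp (-(κ * T P j (blk P j p) y)) := Finset.sum_le_sum fun y _ => hterm y
    _ = Real.exp κ * ∑ y : Site P j, Real.exp (-(κ * T P j (blk P j p) y)) := by rw [Finset.mul_sum]
    _ ≤ Real.exp κ * B4Sect5Proof.latticeConst P.d κ :=
        mul_le_mul_of_nonneg_left (rowSum_T_le P j hκ (blk P j p)) (Real.exp_pos κ).le

/-! ## §3 The three distances of (1.136)–(1.137) and the geometry / row-sum facts -/

/-- `|x − x′|` on `T_η`, `η = L^{−k}`: the sup torus distance of `T^{(0)}` in η-units. [folklore] -/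
def distX (k : ℕ) (x x' : Site P 0) : ℝ := (((P.L : ℝ) ^ k)⁻¹) * T P 0 x x'

/-- The corner representative of a point of the disjoint union of the unit lattices. [folklore] -/
def fineU (y : (i : ℕ) × Site P i) : Site P 0 := fine P y.1 y.2

/-- `|(L^jη)^{−1}x − y|`: the distance, in the `j`-th rescaled torus (unit lattice `T₁^{(j)}` = corner representatives
at spacing 1, fine points at spacing `L^{−j}`), between the rescaled fine point and the unit-lattice point. [folklore] -/
def dXU (j : ℕ) (x : Site P 0) (y : (i : ℕ) × Site P i) : ℝ := (((P.L : ℝ) ^ j)⁻¹) * T P 0 x (fineU P y)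

/-- `|y − y′|` in the `j`-th rescaled torus, through corner representatives (for `y, y′ ∈ T₁^{(j)}`, `j ≤ m + K`, this
IS the own torus distance of `T^{(j)}`: `dUU_level`). [folklore] -/
def dUU (j : ℕ) (y y' : (i : ℕ) × Site P i) : ℝ := (((P.L : ℝ) ^ j)⁻¹) * T P 0 (fineU P y) (fineU P y')

/-- `distX ≥ 0`. [folklore] -/
theorem distX_nonneg (k : ℕ) (x x' : Site P 0) : 0 ≤ distX P k x x' :=
  mul_nonneg (inv_nonneg.mpr (pow_nonneg P.cast_L_pos.le k)) (T_nonneg P 0 x x')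

/-- `dXU ≥ 0`. [folklore] -/
theorem dXU_nonneg (j : ℕ) (x : Site P 0) (y : (i : ℕ) × Site P i) : 0 ≤ dXU P j x y :=
  mul_nonneg (inv_nonneg.mpr (pow_nonneg P.cast_L_pos.le j)) (T_nonneg P 0 _ _)

/-- `dUU ≥ 0`. [folklore] -/
theorem dUU_nonneg (j : ℕ) (y y' : (i : ℕ) × Site P i) : 0 ≤ dUU P j y y' :=
  mul_nonneg (inv_nonneg.mpr (pow_nonneg P.cast_L_pos.le j)) (T_nonneg P 0 _ _)

/-- On level `j ≤ m + K`, `dUU j` is the own sup torus distance of `T^{(j)}`. [folklore] -/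
theorem dUU_level {j : ℕ} (hj : j ≤ P.m + P.K) (y y' : Site P j) : dUU P j ⟨j, y⟩ ⟨j, y'⟩ = T P j y y' := by
  unfold dUU fineU
  rw [T_fine_fine P hj]
  field_simp [(pow_pos P.cast_L_pos j).ne']

/-- `distX x x = 0`. [folklore] -/
theorem distX_self (k : ℕ) (x : Site P 0) : distX P k x x = 0 := by
  unfold distX; rw [T_self, mul_zero]

/-- `distX x x′ = 0 ⇒ x = x′`. [folklore] -/
theorem eq_of_distX_eq_zero {k : ℕ} {x x' : Site P 0} (h : distX P k x x' = 0) : x = x' := by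
  unfold distX at h
  rcases mul_eq_zero.mp h with h0 | h0
  · exact absurd h0 (inv_ne_zero (pow_pos P.cast_L_pos k).ne')
  · exact eq_of_T_eq_zero P h0

/-- THE TRIANGLE INEQUALITY of `Geometry.tri`: `L^{k−j}|x − x′| ≤ |x̃ − y₁| + |y₁ − y₂| + |x̃′ − y₂|` in the `j`-th
rescaled torus (`x̃ = (L^jη)^{−1}x`), for ANY two points `y₁, y₂` of the disjoint union. [folklore] -/
theorem tri {k j : ℕ} (hjk : j ≤ k) (x x' : Site P 0) (y₁ y₂ : (i : ℕ) × Site P i) :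
    (P.L : ℝ) ^ (k - j) * distX P k x x' ≤ dXU P j x y₁ + dUU P j y₁ y₂ + dXU P j x' y₂ := by
  have hL0 : (P.L : ℝ) ≠ 0 := P.cast_L_pos.ne'
  have hLj : (0 : ℝ) < (P.L : ℝ) ^ j := pow_pos P.cast_L_pos j
  have e : (P.L : ℝ) ^ (k - j) * distX P k x x' = (((P.L : ℝ) ^ j)⁻¹) * T P 0 x x' := by
    unfold distX
    rw [pow_sub₀ _ hL0 hjk]
    field_simp
  rw [e]
  unfold dXU dUU
  have h1 := T_triangle P 0 x (fineU P y₁) x'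
  have h2 := T_triangle P 0 (fineU P y₁) (fineU P y₂) x'
  rw [T_symm P 0 (fineU P y₂) x'] at h2
  have hi : 0 ≤ ((P.L : ℝ) ^ j)⁻¹ := inv_nonneg.mpr hLj.le
  have hsum : T P 0 x x' ≤ T P 0 x (fineU P y₁) + T P 0 (fineU P y₁) (fineU P y₂) + T P 0 x' (fineU P y₂) := by
    linarith
  have := mul_le_mul_of_nonneg_left hsum hi
  rw [mul_add, mul_add] at this
  exact this

/-- `Σ_{y ∈ T₁^{(j)}} e^{−κ|x̃ − y|} ≤ e^{κ}K_d(κ)` (`RowSums.rowXU`). [folklore] -/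
theorem rowXU_le {j : ℕ} (hj : j ≤ P.m + P.K) {κ : ℝ} (hκ : 0 < κ) (x : Site P 0) :
    ∑ y ∈ B5Display136Torus.TU P j, Real.exp (-(κ * dXU P j x y)) ≤ Real.exp κ * B4Sect5Proof.latticeConst P.d κ := by
  rw [B5Display136Torus.sum_TU]
  exact rowFine_le P hj hκ x

/-- `Σ_{y′ ∈ T₁^{(j)}} e^{−κ|y − y′|} ≤ e^{κ}K_d(κ)` for any point `y` of the disjoint union (`RowSums.rowUU`). [folklore] -/
theorem rowUU_le {j : ℕ} (hj : j ≤ P.m + P.K) {κ : ℝ} (hκ : 0 < κ) (y : (i : ℕ) × Site P i) :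
    ∑ y' ∈ B5Display136Torus.TU P j, Real.exp (-(κ * dUU P j y y')) ≤ Real.exp κ * B4Sect5Proof.latticeConst P.d κ := by
  rw [B5Display136Torus.sum_TU]
  exact rowFine_le P hj hκ (fineU P y)

/-- Elementary: `(1 + u)e^{−κu} ≤ (1 + 2/κ)e^{−κu/2}` for `u ≥ 0`, `κ > 0`. [folklore] -/
theorem one_add_mul_exp_le {κ u : ℝ} (hκ : 0 < κ) (hu : 0 ≤ u) :
    Real.exp (-(κ * u)) * (1 + u) ≤ (1 + 2 / κ) * Real.exp (-(κ / 2 * u)) := by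
  have hE : 0 < Real.exp (κ / 2 * u) := Real.exp_pos _
  have h1 : κ / 2 * u + 1 ≤ Real.exp (κ / 2 * u) := Real.add_one_le_exp _
  have h2 : u ≤ 2 / κ * Real.exp (κ / 2 * u) := by
    rw [div_mul_eq_mul_div, le_div_iff₀ hκ]
    nlinarith
  have e1 : Real.exp (-(κ * u)) = Real.exp (-(κ / 2 * u)) * Real.exp (-(κ / 2 * u)) := by
    rw [← Real.exp_add]; ring_nf
  have e2 : Real.exp (-(κ / 2 * u)) * Real.exp (κ / 2 * u) = 1 := by
    rw [← Real.exp_add]; simp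
  have hF : 0 < Real.exp (-(κ / 2 * u)) := Real.exp_pos _
  have hF1 : Real.exp (-(κ / 2 * u)) ≤ 1 := by
    rw [Real.exp_le_one_iff]; nlinarith
  rw [e1]
  -- (F·F)(1+u) ≤ (1 + 2/κ) F  ⇐  F (1 + u) ≤ 1 + 2/κ
  have key : Real.exp (-(κ / 2 * u)) * (1 + u) ≤ 1 + 2 / κ := by
    have hu' : Real.exp (-(κ / 2 * u)) * u ≤ 2 / κ := by
      calc Real.exp (-(κ / 2 * u)) * u ≤ Real.exp (-(κ / 2 * u)) * (2 / κ * Real.exp (κ / 2 * u)) :=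
            mul_le_mul_of_nonneg_left h2 hF.le
        _ = 2 / κ * (Real.exp (-(κ / 2 * u)) * Real.exp (κ / 2 * u)) := by ring
        _ = 2 / κ := by rw [e2, mul_one]
    nlinarith
  nlinarith [mul_le_mul_of_nonneg_left key hF.le]

/-- Elementary: `(1 − e^{−t})^{−1} ≤ (1 + t)/t` for `t > 0` (from `1 + t ≤ e^{t}`). [folklore] -/
theorem inv_one_sub_exp_le {t : ℝ} (ht : 0 < t) : (1 - Real.exp (-t))⁻¹ ≤ (1 + t) / t := by
  have h1 : t + 1 ≤ Real.exp t := Real.add_one_le_exp t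
  have hq : 0 < t / (1 + t) := div_pos ht (by linarith)
  have h2 : t / (1 + t) ≤ 1 - Real.exp (-t) := by
    rw [Real.exp_neg]
    have hE : 0 < Real.exp t := Real.exp_pos t
    rw [div_le_iff₀ (by linarith : (0:ℝ) < 1 + t)]
    have : (Real.exp t)⁻¹ * (1 + t) ≤ 1 := by
      rw [inv_mul_le_iff₀ hE]; linarith
    nlinarith
  calc (1 - Real.exp (-t))⁻¹ ≤ (t / (1 + t))⁻¹ := inv_anti₀ hq h2
    _ = (1 + t) / t := inv_div _ _

/-- The explicit Riemann-sum constant `Λ = (1 + 2/κ)(4d/κ + 2)^d` of `RowSums.lat`. [folklore] -/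
def Lam (d : ℕ) (κ : ℝ) : ℝ := (1 + 2 / κ) * (4 * d / κ + 2) ^ d

/-- `Λ ≥ 0`. [folklore] -/
theorem Lam_nonneg (d : ℕ) {κ : ℝ} (hκ : 0 < κ) : 0 ≤ Lam d κ := by
  unfold Lam; positivity

/-- Scale-uniform bound of the rescaled lattice constant: `L^{−jd} K_d(κ/(2L^j)) ≤ (4d/κ + 2)^d` (`d ≥ 1`). [folklore] -/
theorem scaled_latticeConst_le {d : ℕ} (hd : 1 ≤ d) {κ q : ℝ} (hκ : 0 < κ) (hq0 : 0 < q) (hq1 : q ≤ 1) :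
    q ^ d * B4Sect5Proof.latticeConst d (κ / 2 * q) ≤ (4 * d / κ + 2) ^ d := by
  unfold B4Sect5Proof.latticeConst
  rw [← mul_pow]
  have hdpos : (0 : ℝ) < d := by exact_mod_cast hd
  set t : ℝ := κ / 2 * q / d with ht
  have htpos : 0 < t := by rw [ht]; positivity
  have hbase : q * (2 * (1 - Real.exp (-(κ / 2 * q / d)))⁻¹) ≤ 4 * d / κ + 2 := by
    have hi := inv_one_sub_exp_le htpos
    rw [← ht]
    calc q * (2 * (1 - Real.exp (-t))⁻¹) ≤ q * (2 * ((1 + t) / t)) := by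
          apply mul_le_mul_of_nonneg_left _ hq0.le
          exact mul_le_mul_of_nonneg_left hi (by norm_num)
      _ = 4 * d / κ + 2 * q := by
          rw [ht]; field_simp; ring
      _ ≤ 4 * d / κ + 2 := by nlinarith
  have hbase0 : 0 ≤ q * (2 * (1 - Real.exp (-(κ / 2 * q / d)))⁻¹) := by
    apply mul_nonneg hq0.le
    apply mul_nonneg (by norm_num)
    apply inv_nonneg.mpr
    rw [sub_nonneg, Real.exp_le_one_iff]
    have : 0 < κ / 2 * q / d := by positivity
    linarith
  exact pow_le_pow_left₀ hbase0 hbase d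

/-- `RowSums.lat`: the Riemann sum of the display, `Σ_{x′∈T_η} L^{−jd} e^{−κ u}(1 + u)`, `u = |(L^jη)^{−1}(x − x′)|`,
is `≤ Λ = (1 + 2/κ)(4d/κ + 2)^d`, uniformly in `j`, `k` and the torus. [folklore] -/
theorem lat_le {k j : ℕ} (hjk : j ≤ k) {κ : ℝ} (hκ : 0 < κ) (x : Site P 0) :
    ∑ x' : Site P 0, ((P.L : ℝ) ^ (j * P.d))⁻¹ * (Real.exp (-(κ * ((P.L : ℝ) ^ (k - j) * distX P k x x'))) *
      (1 + (P.L : ℝ) ^ (k - j) * distX P k x x')) ≤ Lam P.d κ := by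
  have hL0 : (P.L : ℝ) ≠ 0 := P.cast_L_pos.ne'
  have hLj : (0 : ℝ) < (P.L : ℝ) ^ j := pow_pos P.cast_L_pos j
  set q : ℝ := ((P.L : ℝ) ^ j)⁻¹ with hq
  have hq0 : 0 < q := by rw [hq]; exact inv_pos.mpr hLj
  have hq1 : q ≤ 1 := by
    rw [hq]; apply inv_le_one_of_one_le₀; exact one_le_pow₀ (by exact_mod_cast P.L_pos)
  have eu : ∀ x' : Site P 0, (P.L : ℝ) ^ (k - j) * distX P k x x' = q * T P 0 x x' := by
    intro x'
    unfold distX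
    rw [pow_sub₀ _ hL0 hjk, hq]
    field_simp
  have epow : ((P.L : ℝ) ^ (j * P.d))⁻¹ = q ^ P.d := by
    rw [hq, pow_mul, inv_pow]
  simp_rw [eu, epow]
  have hterm : ∀ x' : Site P 0, q ^ P.d * (Real.exp (-(κ * (q * T P 0 x x'))) * (1 + q * T P 0 x x')) ≤
      q ^ P.d * ((1 + 2 / κ) * Real.exp (-((κ / 2 * q) * T P 0 x x'))) := by
    intro x'
    apply mul_le_mul_of_nonneg_left _ (pow_nonneg hq0.le _)
    have h := one_add_mul_exp_le hκ (mul_nonneg hq0.le (T_nonneg P 0 x x'))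
    rw [show κ / 2 * q * T P 0 x x' = κ / 2 * (q * T P 0 x x') by ring]
    exact h
  calc ∑ x' : Site P 0, q ^ P.d * (Real.exp (-(κ * (q * T P 0 x x'))) * (1 + q * T P 0 x x'))
      ≤ ∑ x' : Site P 0, q ^ P.d * ((1 + 2 / κ) * Real.exp (-((κ / 2 * q) * T P 0 x x'))) :=
        Finset.sum_le_sum fun x' _ => hterm x'
    _ = (1 + 2 / κ) * (q ^ P.d * ∑ x' : Site P 0, Real.exp (-((κ / 2 * q) * T P 0 x x'))) := by
        rw [Finset.mul_sum, Finset.mul_sum]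
        apply Finset.sum_congr rfl; intro x' _; ring
    _ ≤ (1 + 2 / κ) * (q ^ P.d * B4Sect5Proof.latticeConst P.d (κ / 2 * q)) := by
        apply mul_le_mul_of_nonneg_left _ (by positivity)
        exact mul_le_mul_of_nonneg_left (rowSum_T_le P 0 (by positivity) x) (pow_nonneg hq0.le _)
    _ ≤ (1 + 2 / κ) * (4 * P.d / κ + 2) ^ P.d :=
        mul_le_mul_of_nonneg_left (scaled_latticeConst_le P.hd hκ hq0 hq1) (by positivity)
    _ = Lam P.d κ := rfl

/-! ## §4 The norms (1.108)–(1.109) on scalar functions -/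

/-- `|f| = sup_x |f(x)|` ((1.108) for a scalar function). [cite: Balaban1984PropagatorsI, (1.108) p.35] -/
def supN (f : Site P 0 → ℝ) : ℝ := Finset.univ.sup' Finset.univ_nonempty (fun x => |f x|)

/-- `‖f‖_ε = sup_{x,x′ : |x−x′| ≤ 1} |x − x′|^{−ε}|f(x) − f(x′)|` ((1.109) for a scalar function; pairs with `x = x′`
contribute `0`). [cite: Balaban1984PropagatorsI, (1.109) p.35] -/
def holN (k : ℕ) (ε : ℝ) (f : Site P 0 → ℝ) : ℝ :=
  Finset.univ.sup' Finset.univ_nonempty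
    (fun p : Site P 0 × Site P 0 => if distX P k p.1 p.2 ≤ 1 then |f p.2 - f p.1| / distX P k p.1 p.2 ^ ε else 0)

/-- `|f(x)| ≤ |f|`. [folklore] -/
theorem le_supN (f : Site P 0 → ℝ) (x : Site P 0) : |f x| ≤ supN P f :=
  Finset.le_sup' (fun x => |f x|) (Finset.mem_univ x)

/-- `|f| ≥ 0`. [folklore] -/
theorem supN_nonneg (f : Site P 0 → ℝ) : 0 ≤ supN P f :=
  le_trans (abs_nonneg _) (le_supN P f default)

/-- `‖f‖_ε ≥ 0` (the diagonal pair contributes `0`). [folklore] -/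
theorem holN_nonneg (k : ℕ) (ε : ℝ) (f : Site P 0 → ℝ) : 0 ≤ holN P k ε f := by
  have h := Finset.le_sup' (fun p : Site P 0 × Site P 0 =>
      if distX P k p.1 p.2 ≤ 1 then |f p.2 - f p.1| / distX P k p.1 p.2 ^ ε else 0)
    (Finset.mem_univ ((default : Site P 0), (default : Site P 0)))
  have h0 : (if distX P k (default : Site P 0) default ≤ 1 then
      |f default - f default| / distX P k (default : Site P 0) default ^ ε else 0) = (0 : ℝ) := by
    simp
  rw [h0] at h
  exact h

/-- The Hölder bound `|f(x′) − f(x)| ≤ ‖f‖_ε |x − x′|^ε` for `|x − x′| ≤ 1`, `ε > 0`. [folklore] -/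
theorem holder_le (k : ℕ) {ε : ℝ} (hε : 0 < ε) (f : Site P 0 → ℝ) (x x' : Site P 0) (h1 : distX P k x x' ≤ 1) :
    |f x' - f x| ≤ holN P k ε f * distX P k x x' ^ ε := by
  rcases eq_or_lt_of_le (distX_nonneg P k x x') with h0 | hpos
  · have hxx : x = x' := eq_of_distX_eq_zero P h0.symm
    subst hxx
    rw [sub_self, abs_zero, distX_self, Real.zero_rpow hε.ne', mul_zero]
  · have hq : |f x' - f x| / distX P k x x' ^ ε ≤ holN P k ε f := by
      have h := Finset.le_sup' (fun p : Site P 0 × Site P 0 =>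
          if distX P k p.1 p.2 ≤ 1 then |f p.2 - f p.1| / distX P k p.1 p.2 ^ ε else 0)
        (Finset.mem_univ (x, x'))
      simp only [h1, if_true] at h
      exact h
    have hDε : 0 < distX P k x x' ^ ε := Real.rpow_pos_of_pos hpos ε
    rwa [div_le_iff₀ hDε] at hq

/-! ## §5 The concrete auxiliary data and (1.137) for the concrete tower -/

variable (S : B5.Setting)

/-- The concrete auxiliary data of `B5Display136Torus.scaleData`: the norms of §4, the distances of §3 (η = L^{−S.k}),
and the two remaining free inputs — the cube relation `x ∈ Δ̃(y)` towards the ABSTRACT unit-lattice sites of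
`B5.Setting` and the component map `J ↦ J_ν`. [folklore] -/
def aux (cube : Site P 0 → S.Site → Prop) (comp : S.Loc → Fin P.d → (Site P 0 → ℝ)) : B5Display136Torus.Aux P S where
  holderF := holN P S.k
  supF := supN P
  comp := comp
  cube := cube
  distX := distX P S.k
  dXU := dXU P
  dUU := dUU P

/-- The two CUBE FACTS of p. 35 (*"Cubes Δ̃(y) are … cubes of size 2 and with a center at y"*), the only geometric
inputs that involve the abstract sites `S.Site` / distance `S.dist` of `B5.Setting` and so cannot be proved for the
concrete torus alone: `x ∈ Δ̃(y), x′ ∈ Δ̃(y′) ⇒ |y − y′| − c ≤ |x − x′|` and `x ∈ Δ̃(y) ∩ Δ̃(y′) ⇒ |y − y′| ≤ c`.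
[folklore] -/
structure CubeFacts (cube : Site P 0 → S.Site → Prop) (cc : ℝ) : Prop where
  sep : ∀ (x x' : Site P 0) (y y' : S.Site), cube x y → cube x' y' → S.dist y y' - cc ≤ distX P S.k x x'
  near : ∀ (x : Site P 0) (y y' : S.Site), cube x y → cube x y' → S.dist y y' ≤ cc

variable {P S}

/-- `Geometry` of the concrete data: the four distance facts are THEOREMS (§3), the two cube facts are the
hypothesis `CubeFacts`. [folklore] -/
theorem geometry {cube : Site P 0 → S.Site → Prop} {comp : S.Loc → Fin P.d → (Site P 0 → ℝ)} {cc : ℝ}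
    (hC : CubeFacts P S cube cc) (a msq : ℝ) :
    B5Ineq137.Geometry (B5Display136Torus.scaleData P S (aux P S cube comp) a msq) P.L cc where
  distX_nonneg := fun x x' => distX_nonneg P S.k x x'
  dXU_nonneg := fun j x y => dXU_nonneg P j x y
  dUU_nonneg := fun j y y' => dUU_nonneg P j y y'
  tri := fun _ x x' y₁ y₂ _ hjk => tri P hjk.le x x' y₁ y₂
  cube_sep := hC.sep
  cube_near := hC.near

/-- `RowSums` of the concrete data at every rate `κ > 0`, with `R = e^{κ}K_d(κ)` and `Λ = (1 + 2/κ)(4d/κ + 2)^d`,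
for `S.k ≤ m + K + 1` (all levels `j < S.k` are genuine tori `T^{(j)}`, `j ≤ m + K`). [folklore] -/
theorem rowSums {cube : Site P 0 → S.Site → Prop} {comp : S.Loc → Fin P.d → (Site P 0 → ℝ)}
    (hk : S.k ≤ P.m + P.K + 1) {κ : ℝ} (hκ : 0 < κ) (a msq : ℝ) :
    B5Ineq137.RowSums (B5Display136Torus.scaleData P S (aux P S cube comp) a msq) P.L P.d κ
      (Real.exp κ * B4Sect5Proof.latticeConst P.d κ) (Lam P.d κ) where
  R_nonneg := mul_nonneg (Real.exp_pos κ).le (B4Sect5Proof.latticeConst_nonneg P.d hκ.le)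
  Λ_nonneg := Lam_nonneg P.d hκ
  rowXU := fun j x _ hj => rowXU_le P (by omega) hκ x
  rowUU := fun j y _ hj => rowUU_le P (by omega) hκ y
  lat := fun j x hj _ => lat_le P hj.le hκ x

/-- `NormFacts` of the concrete data: THEOREMS (§4). [folklore] -/
theorem normFacts {cube : Site P 0 → S.Site → Prop} {comp : S.Loc → Fin P.d → (Site P 0 → ℝ)} (a msq : ℝ) :
    B5Ineq137.NormFacts (B5Display136Torus.scaleData P S (aux P S cube comp) a msq) where
  holder_le := fun _ f x x' hε h1 => holder_le P S.k hε f x x' h1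
  sup_le := fun f x => le_supN P f x
  holder_nonneg := fun ε f => holN_nonneg P S.k ε f
  sup_nonneg := fun f => supN_nonneg P f

/-- **(1.137) for the concrete scalar torus tower with the model-evident hypotheses discharged.**  For the concrete
data (`B5Display136Torus.scaleData` with the auxiliary data `aux`: sup torus distances through corner representatives,
the norms (1.108)–(1.109)), `1 ≤ S.k ≤ m + K + 1`, `a > 0`, `m² ≥ 0`: the located leaf `Leaf235to237` (the decay
estimates of [4] Lemma 2.4 read on the whole torus, p. 39, the four lines before (1.135) — NOT proved here) at rate `δ′₀` and the two cube
facts `CubeFacts` imply (1.137) with `δ = ½δ′₀` and the explicit constant below (`R = e^{δ′₀/4}K_d(δ′₀/4)`,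
`Λ = (1 + 8/δ′₀)(16d/δ′₀ + 2)^d`).  The operator identity (1.136) (`display136_of_tower`), the triangle inequality, the
row sums and the norm facts are all KERNEL THEOREMS now; compare `B5Display136Torus.ineq137_of_tower`, where
`Geometry`, `RowSums`, `NormFacts` were hypotheses. [cite: Balaban1984PropagatorsI, (1.135)–(1.137) pp.39–40] -/
theorem ineq137_torus {cube : Site P 0 → S.Site → Prop} {comp : S.Loc → Fin P.d → (Site P 0 → ℝ)}
    {a msq : ℝ} (ha : 0 < a) (hm : 0 ≤ msq) (hk : 1 ≤ S.k) (hkK : S.k ≤ P.m + P.K + 1)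
    (c₀ δ₀' cc ā : ℝ) (hc₀ : 0 ≤ c₀) (hδ : 0 < δ₀') (hā : ∀ j, |B1.aSeq a P.L j| ≤ ā)
    (hleaf : B5Ineq137.Leaf235to237 (B5Display136Torus.scaleData P S (aux P S cube comp) a msq) P.L c₀ δ₀')
    (hC : CubeFacts P S cube cc) :
    B5Ineq137.Ineq137 (B5Display136Torus.scaleData P S (aux P S cube comp) a msq)
      (fun ε => 2 * ((c₀ + ā ^ 2 * c₀ ^ 3 * (Real.exp (δ₀' / 4) * B4Sect5Proof.latticeConst P.d (δ₀' / 4)) ^ 2) *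
        Real.exp (δ₀' / 2 * cc) * Lam P.d (δ₀' / 4)) / ((P.L : ℝ) ^ ε - 1)) (δ₀' / 2) :=
  B5Display136Torus.ineq137_of_tower P S (aux P S cube comp) ha hm hk c₀ δ₀' cc ā
    (Real.exp (δ₀' / 4) * B4Sect5Proof.latticeConst P.d (δ₀' / 4)) (Lam P.d (δ₀' / 4)) hc₀ hδ hā hleaf
    (geometry hC a msq) (rowSums hkK (by positivity) a msq) (normFacts a msq)


/-! ## §6 The model cube relation: the cube facts PROVED under an isometric identification of the abstract sites -/

/-- The MODEL cube relation transported through a map `σ : S.Site → T^{(k)}`: `x ∈ Δ̃(y)` iff the fine point `x` lies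
within sup-distance `1` (η-units; `L^k` fine steps) of the corner representative of `σ y` — *"cubes of size 2 and
with a center at y"* (p. 35), centre read at the corner representative (DIVERGENCE F3). [folklore] -/
def modelCube (k : ℕ) (σ : S.Site → Site P k) (x : Site P 0) (y : S.Site) : Prop :=
  T P 0 x (fine P k (σ y)) ≤ (P.L : ℝ) ^ k

/-- Under an ISOMETRIC identification `σ` of the abstract unit-lattice sites with `T^{(k)}` (`S.dist y y′` = the sup
torus distance of `σ y, σ y′`), the model cube relation satisfies BOTH cube facts with `c = 2` — theorems of the
triangle inequality. [folklore] -/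
theorem cubeFacts_model (hk : S.k ≤ P.m + P.K) (σ : S.Site → Site P S.k)
    (hσ : ∀ y y' : S.Site, S.dist y y' = T P S.k (σ y) (σ y')) : CubeFacts P S (modelCube S.k σ) 2 where
  sep := by
    intro x x' y y' hx hx'
    unfold modelCube at hx hx'
    rw [hσ]
    unfold distX
    have hLk : (0 : ℝ) < (P.L : ℝ) ^ S.k := pow_pos P.cast_L_pos _
    have e := T_fine_fine P hk (σ y) (σ y')
    have t1 := T_triangle P 0 (fine P S.k (σ y)) x (fine P S.k (σ y'))
    have t2 := T_triangle P 0 x x' (fine P S.k (σ y'))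
    rw [T_symm P 0 (fine P S.k (σ y)) x] at t1
    have h : (P.L : ℝ) ^ S.k * T P S.k (σ y) (σ y') ≤ 2 * (P.L : ℝ) ^ S.k + T P 0 x x' := by
      rw [← e]; linarith
    have h' := mul_le_mul_of_nonneg_left h (inv_nonneg.mpr hLk.le)
    rw [← mul_assoc, inv_mul_cancel₀ hLk.ne', one_mul, mul_add,
      show ((P.L : ℝ) ^ S.k)⁻¹ * (2 * (P.L : ℝ) ^ S.k) = 2 by field_simp] at h'
    linarith
  near := by
    intro x y y' hx hx'
    unfold modelCube at hx hx'
    rw [hσ]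
    have hLk : (0 : ℝ) < (P.L : ℝ) ^ S.k := pow_pos P.cast_L_pos _
    have e := T_fine_fine P hk (σ y) (σ y')
    have t := T_triangle P 0 (fine P S.k (σ y)) x (fine P S.k (σ y'))
    rw [T_symm P 0 (fine P S.k (σ y)) x] at t
    have h : (P.L : ℝ) ^ S.k * T P S.k (σ y) (σ y') ≤ (P.L : ℝ) ^ S.k * 2 := by
      rw [← e]; linarith
    exact le_of_mul_le_mul_left h hLk

/-- **(1.137), fully concrete geometry.**  With the model cube relation under an isometric identification `σ` of
`S.Site` with `T^{(k)}`, `1 ≤ S.k ≤ m + K`: the located leaf `Leaf235to237` ALONE implies (1.137) (`c = 2`,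
`δ = ½δ′₀`; constants as in `ineq137_torus`).  Every model-evident hypothesis of `B5Ineq137.ineq137_of_display136`
— (1.136), geometry incl. the cube facts, row sums, norm facts — is a kernel theorem here; what remains is exactly
the located leaf ([4] Lemma 2.4 / (2.35)–(2.37) on the torus, residue (R3) of the cell record) and the identification
`σ`. [cite: Balaban1984PropagatorsI, (1.135)–(1.137) pp.39–40] -/
theorem ineq137_torus_model {comp : S.Loc → Fin P.d → (Site P 0 → ℝ)}
    {a msq : ℝ} (ha : 0 < a) (hm : 0 ≤ msq) (hk : 1 ≤ S.k) (hkK : S.k ≤ P.m + P.K)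
    (σ : S.Site → Site P S.k) (hσ : ∀ y y' : S.Site, S.dist y y' = T P S.k (σ y) (σ y'))
    (c₀ δ₀' ā : ℝ) (hc₀ : 0 ≤ c₀) (hδ : 0 < δ₀') (hā : ∀ j, |B1.aSeq a P.L j| ≤ ā)
    (hleaf : B5Ineq137.Leaf235to237
      (B5Display136Torus.scaleData P S (aux P S (modelCube S.k σ) comp) a msq) P.L c₀ δ₀') :
    B5Ineq137.Ineq137 (B5Display136Torus.scaleData P S (aux P S (modelCube S.k σ) comp) a msq)
      (fun ε => 2 * ((c₀ + ā ^ 2 * c₀ ^ 3 * (Real.exp (δ₀' / 4) * B4Sect5Proof.latticeConst P.d (δ₀' / 4)) ^ 2) *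
        Real.exp (δ₀' / 2 * 2) * Lam P.d (δ₀' / 4)) / ((P.L : ℝ) ^ ε - 1)) (δ₀' / 2) :=
  ineq137_torus ha hm hk (by omega) c₀ δ₀' 2 ā hc₀ hδ hā hleaf (cubeFacts_model hkK σ hσ)

end

end B5Ineq137Torus

end Literature.MathematicalPhysics.QuantumFieldTheory.Balaban1983to89
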